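/-
Copyright (c) 2026. All rights reserved.
Released under Apache 2.0 license as described in the file LICENSE.
Authors: abc-iut cell, prover seat abc-iut-w5-d096 (gen 8; row «PUNCTURED-HIGHER-GENUS-IDRIGID», part 3 = the
zero-residual consumer of abc-iut-w5-d038's row «FC-TOPOLOGICAL» `HolRS.cuspClasses_finite_ofOpens_compl_finite`).
-/
import Literature.AnabelianGeometry.AbsoluteAnabelian.ArchimedeanHolFieldFunctorGeometricPSLPuncturedGenuineRC
import Literature.AnabelianGeometry.AbsoluteAnabelian.ArchimedeanHolFieldFunctorGeometricPSLCuspClasses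
import HarnessLib

/-!
# [AbsTopIII] Prop 4.2 (i) / Cor 4.5 at EVERY non-compact Riemann surface of finite type — ZERO cusp residual
# (PROOF-ONLY; holomorphic and print-faithful RC morphisms)

S. Mochizuki, *Topics in Absolute Anabelian Geometry III*, proof of Prop 4.2 (i), kurims p.106 l.11–19; Cor 4.5
pp.107–109; Cor 2.4 p.54 («a hyperbolic Aut-holomorphic space of finite type … determined by a hyperbolic curve over ℂ»)
[MochizukiAbsTopIII2015].  Parts 1–2 of this row (`…PSLPuncturedGenuine`, `…PSLPuncturedGenuineRC`) assembled the
geometric column at genuine punctured surfaces modulo the cusp datum (FC) of the Möbius deck group; abc-iut-w5-d038's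
row «FC-TOPOLOGICAL» (`ArchimedeanHolFieldFunctorGeometricPSLCuspClasses`, Shimizu height bound + horoball exits to ONE
puncture + chart-end monodromy comparison — Picard-free) PROVES (FC) for every holomorphic covering `ℍ → M ∖ S` of a
punctured COMPACT Riemann surface.  This file consumes it BY NAME:

* `HolRS.secondCountableTopology_of_isOfFiniteType` — finite type ⇒ second countable (bookkeeping);
* `HolRS.cuspClasses_of_cover_of_isOfFiniteType` — (FC) for the deck group of EVERY uniformising covering of EVERY
  non-compact Riemann surface OF FINITE TYPE (transport along the witness biholomorphism `X ≅ X̄ ∖ S`, which does not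
  change the deck group — as for (P) in part 1);
* ★★★ `HolRS.isIdRigid_EA_and_cor_4_5_full_mapsTo_of_isOfFiniteType` and its RC twin — **Prop 4.2 (i) id-rigidity of
  «objects of `EA` mapping to `X`» and `Cor_4_5_full`, at EVERY non-compact connected Riemann surface of finite type whose
  fundamental group is free of finite rank or an orientable surface group and non-abelian — hypotheses {finite type,
  non-compact, `hπ`, `hab`} ONLY: no (P), no (FC), no `hN`, no `hfin`, no named fact.**  At genus `≤ 1` (`ℂ ∖ F`, `E ∖ S`)
  `hπ`/`hab` are theorems of the tree (free `π₁` of rank `≥ 2`), so this is a second, uniformisation-theoretic route to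
  the cells closed by the (H1′)/(OUT) routes; at punctured genus `≥ 2` the topological input (α) `IsFreeOrSurface π₁`
  alone remains (like `IsOrientableSurfaceGroup` in the compact column).

Everything is a theorem; no definition, no instance, no named fact.  HONEST FRAMING: classical; MODEL side of [AbsTopIII]
§4 (model ≠ reconstruction ≠ node; NODES `AbsTopIII:Prop4.2(i)`/`Cor4.5` geometric column, support library); nothing here
bears on the disputed [IUTchIII] Cor. 3.12.
-/

set_option autoImplicit false

noncomputable section

namespace Literature.AnabelianGeometry.AbsoluteAnabelian

namespace HolRS

open scoped _root_.Manifold _root_.ContDiff _root_.Topology UpperHalfPlane MatrixGroups Matrix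
open _root_.MulAction _root_.Function _root_.CategoryTheory _root_.TopologicalSpace
open Literature.IUT.HodgeTheaters (IsFreeOrSurface)

/-- A Riemann surface of finite type is second countable (it is homeomorphic to an open subset of a compact — hence
σ-compact, hence second-countable — Riemann surface). [cite: MochizukiAbsTopIII2015, Corollary 2.4 p.54] -/
theorem secondCountableTopology_of_isOfFiniteType (X : HolRS) (hX : IsOfFiniteType X.carrier) :
    SecondCountableTopology X.carrier := by
  obtain ⟨⟨Xc, S, e, -, -⟩⟩ := hX
  haveI : SecondCountableTopology Xc := ChartedSpace.secondCountable_of_sigmaCompact ℂ Xc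
  exact e.secondCountableTopology

section Transport

variable (X : HolRS)

/-- **(FC) for the deck group of EVERY uniformising covering of EVERY Riemann surface of finite type** (abc-iut-w5-d038's
`cuspClasses_finite_ofOpens_compl_finite` at the punctured COMPACT surface `X̄ ∖ S`, transported along the witness
biholomorphism `e : X ≅ X̄ ∖ S` exactly as `exists_parabolic_mem_of_cover_of_isOfFiniteType` transports (P): the covering
`e ∘ k` of `X̄ ∖ S` has the SAME Möbius deck group as `k`). [cite: MochizukiAbsTopIII2015, Proposition 4.2 (i) proof p.106]
[cite: FarkasKra1992, IV.5.5–IV.5.6] -/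
theorem cuspClasses_of_cover_of_isOfFiniteType (hX : IsOfFiniteType X.carrier)
    {k : ℍ → X.carrier} (hk : IsCoveringMap k) (dk : MDifferentiable 𝓘(ℂ, ℂ) 𝓘(ℂ, ℂ) k) (Λ : Subgroup PSL2R)
    (hΛ : ∀ q : PSL2R, q ∈ Λ ↔ ∀ τ : ℍ, k (q • τ) = k τ) :
    ∃ F : Finset (Fin 2 → ℝ), ∀ t : SL(2, ℝ),
      QuotientGroup.mk' (Subgroup.center SL(2, ℝ)) t ∈ Λ → (t : Matrix (Fin 2) (Fin 2) ℝ).IsParabolic →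
      ∀ v : Fin 2 → ℝ, v ≠ 0 → (∃ c : ℝ, (t : Matrix (Fin 2) (Fin 2) ℝ) *ᵥ v = c • v) →
      ∃ g : SL(2, ℝ), QuotientGroup.mk' (Subgroup.center SL(2, ℝ)) g ∈ Λ ∧ ∃ w ∈ F, ∃ c : ℝ,
        (g : Matrix (Fin 2) (Fin 2) ℝ) *ᵥ v = c • w := by
  -- unpack the finite-type witness `e : X ≅ X̄ ∖ S` (`X̄` compact)
  obtain ⟨⟨Xc, S, e, hol, -⟩⟩ := hX
  -- `X̄ ∖ S` is connected (continuous image of the connected `X`)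
  have hconn : IsConnected (((S : Set Xc))ᶜ) := by
    have hr : Set.range (Subtype.val ∘ e) = ((S : Set Xc))ᶜ := by
      rw [e.surjective.range_comp]
      exact Subtype.range_coe
    rw [← hr]
    exact isConnected_range (continuous_subtype_val.comp e.continuous)
  -- the transported uniformising covering `e ∘ k : ℍ → X̄ ∖ S` has the same Möbius deck group
  have hk' : IsCoveringMap (e ∘ k) := hk.homeomorph_comp e
  have dk' : MDifferentiable 𝓘(ℂ, ℂ) 𝓘(ℂ, ℂ) (e ∘ k) := hol.comp dk
  have hΛ' : ∀ q : PSL2R, q ∈ Λ ↔ ∀ τ : ℍ, (e ∘ k) (q • τ) = (e ∘ k) τ := by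
    intro q
    rw [hΛ q]
    simp only [Function.comp_apply, EmbeddingLike.apply_eq_iff_eq]
  -- (FC) at the genuine punctured compact surface `X̄ ∖ S` (abc-iut-w5-d038, row «FC-TOPOLOGICAL»)
  exact cuspClasses_finite_ofOpens_compl_finite S.finite_toSet hconn hk' dk' Λ hΛ'

/-- ★★★ **[AbsTopIII] Prop 4.2 (i) id-rigidity of «objects of `EA` mapping to `X`» and `Cor_4_5_full`, at EVERY
non-compact connected Riemann surface OF FINITE TYPE whose fundamental group is free of finite rank or an orientable surface
group and non-abelian — ZERO cusp residual** (holomorphic morphisms): no (P), no (FC), no `hN`, no `hfin`, no named fact;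
part 1's `…_of_isOfFiniteType_of_cuspClasses` fed with `cuspClasses_of_cover_of_isOfFiniteType`.  At genus `≤ 1` the
binders `hπ`/`hab` are theorems of the tree; at punctured genus `≥ 2` the topological input (α) `IsFreeOrSurface π₁` alone
remains. [cite: MochizukiAbsTopIII2015, Proposition 4.2 (i) proof p.106]
[cite: MochizukiAbsTopIII2015, Corollary 4.5 pp.107–109] [cite: FarkasKra1992, IV.5.5–IV.5.6] -/
theorem isIdRigid_EA_and_cor_4_5_full_mapsTo_of_isOfFiniteType
    (hX : IsOfFiniteType X.carrier) (hnc : ¬ CompactSpace X.carrier) (x₀ : X.carrier)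
    (hπ : IsFreeOrSurface (FundamentalGroup X.carrier x₀))
    (hab : ∃ a b : FundamentalGroup X.carrier x₀, a * b ≠ b * a) :
    IsIdRigid (geometricAutHolFieldFunctor fun Y : HolRS => Nonempty (Y ⟶ X)).EA ∧
      AbsTopIII.Cor_4_5_full
        (archLogFrobeniusData (geometricAutHolFieldFunctor fun Y : HolRS => Nonempty (Y ⟶ X)))
        (archTelecoreData (geometricAutHolFieldFunctor fun Y : HolRS => Nonempty (Y ⟶ X))) := by
  haveI := secondCountableTopology_of_isOfFiniteType X hX
  refine X.isIdRigid_EA_and_cor_4_5_full_mapsTo_of_isOfFiniteType_of_cuspClasses hX hnc x₀ hπ hab ?_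
  intro k hk dk Λ hΛ
  obtain ⟨Λ₁, hPD₁, hC₁, hΛ₁, -⟩ := exists_pslQuotient_iso_of_cover_transport X hk dk
  have hΛeq : Λ = Λ₁ := by
    ext q
    rw [hΛ q, hΛ₁ q]
  subst hΛeq
  exact cuspClasses_of_cover_of_isOfFiniteType X hX hk dk Λ hΛ

/-- ★★★ **The same for print's RC-holomorphic (holomorphic AND anti-holomorphic finite étale) morphisms** (Def 4.1 (iii) /
Cor 2.3 (i)): part 2's `RC.…_of_isOfFiniteType_of_cuspClasses` fed with `cuspClasses_of_cover_of_isOfFiniteType`.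
[cite: MochizukiAbsTopIII2015, Proposition 4.2 (i) proof p.106] [cite: MochizukiAbsTopIII2015, Corollary 4.5 pp.107–109] -/
theorem RC.isIdRigid_EA_and_cor_4_5_full_mapsTo_of_isOfFiniteType
    (hX : IsOfFiniteType X.carrier) (hnc : ¬ CompactSpace X.carrier) (x₀ : X.carrier)
    (hπ : IsFreeOrSurface (FundamentalGroup X.carrier x₀))
    (hab : ∃ a b : FundamentalGroup X.carrier x₀, a * b ≠ b * a) :
    IsIdRigid (geometricAutHolFieldFunctorRC fun Y : RC => Nonempty (Y ⟶ toRC.obj X)).EA ∧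
      AbsTopIII.Cor_4_5_full
        (archLogFrobeniusData (geometricAutHolFieldFunctorRC fun Y : RC => Nonempty (Y ⟶ toRC.obj X)))
        (archTelecoreData (geometricAutHolFieldFunctorRC fun Y : RC => Nonempty (Y ⟶ toRC.obj X))) := by
  haveI := secondCountableTopology_of_isOfFiniteType X hX
  refine RC.isIdRigid_EA_and_cor_4_5_full_mapsTo_of_isOfFiniteType_of_cuspClasses X hX hnc x₀ hπ hab ?_
  intro k hk dk Λ hΛ
  obtain ⟨Λ₁, hPD₁, hC₁, hΛ₁, -⟩ := exists_pslQuotient_iso_of_cover_transport X hk dk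
  have hΛeq : Λ = Λ₁ := by
    ext q
    rw [hΛ q, hΛ₁ q]
  subst hΛeq
  exact cuspClasses_of_cover_of_isOfFiniteType X hX hk dk Λ hΛ

end Transport

end HolRS

end Literature.AnabelianGeometry.AbsoluteAnabelian

end
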